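import Summits.HubbardSuperconductivity.HubbardSuperconductivity.Theses.AposterioriCapRg

/-!
# Crux `SeededBrokenRegimeBoseFermiPinned` (item `stmt-HubbardSuperconductivity-14047`): load-bearing
# quantifiers and the free velocities of nodeless data — support lemmas from the standing disprover (cycle 1)

The crux (`[3]` of route AposterioriCapRg) reads `∀ kStar etaStar > 0, ∃ Θ, ∀ (U, δ, μ)` in the box with
the density clause, `∀ K Λ L₀, symmetricRegimeCertificateT U μ capRgCornerDataT Θ K Λ L₀ → Concl`, with
`Concl = ∃ h₀ > 0, ∃ D, D.MeetsThresholds kStar etaStar ∧ 0 < D.numPatches ∧ 0 < D.meanFieldDensity.fst ∧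
∀ h ∈ (0, h₀], ∃ L₀', D.IsCertifiedEnclosure (hubbardScaleReportCT U μ D h) L₀'` (spelled out below; no
named `Prop` is introduced).  Neither `S` nor `¬S` is reachable in the tree: a certified point is crux `[2]`
(`CapRgSymmetricCertificatePinned`, stmt-14045) and the conclusion's functionals are opaque at
`U ∈ [2,3]`.  This file proves what IS kernel-checkable:

* `certifiedAtT_mono_tol`, `certificateT_mono_tol`, `seededBrokenRegime_body_antitone` — the v3
  certificate is monotone in the tolerance `Θ = (c₀, w)` (it enters only through `c₀ Λ` in (0b′) and
  `b - a ≤ w`), so the body of the crux is ANTITONE in `Θ`: "`∃ Θ`" is witnessed by every smaller one;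
* `seededBrokenRegime_concl_etaStar_nonneg` — UNCONDITIONALLY the conclusion forces `0 ≤ etaStar`
  (reported remainder norms are `≥ 0`, `remainderNorm_nonneg_of_mem_reportCT`); hence
  `seededBrokenRegime_anyEta_false_of_capRg`: with the sign condition on `etaStar` dropped the statement
  is false at `[2]`'s certified point (witness `etaStar = -1`) — `0 < etaStar` is load-bearing up to `0 ≤`;
* `hubbardScaleData_not_forall_meetsThresholds` — no single datum meets all stiffness thresholds
  (`kStar Λ₀ v_F.snd ≤ ρ_s.fst` fails at `kStar = (|ρ_s.fst| + 1)/(Λ₀ v_F.snd)`); hence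
  `seededBrokenRegime_uniformDatum_false_of_capRg`: the strengthening with ONE datum for all thresholds
  (`∃ h₀ D` before `∀ kStar etaStar`) is false at `[2]`'s point — the quantifier order is load-bearing;
* `isRealisedAtCT_setVel`, `mem_hubbardScaleReportCTAt_setVel`, `isCertifiedEnclosure_setVel`,
  `seededBrokenRegime_concl_velocities_decorative` — in `IsRealisedAtCT` the velocities occur ONLY in the
  nodal pins, so for a datum with EMPTY nodal set (any `numPatches`: `0 < D.numPatches` does not help) the
  report is invariant under re-assigning `v_F`, `v_Δ`, and a `Concl`-witness can be re-certified with both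
  velocity enclosures equal to `[ε, ε]` for every small rational `ε > 0` without model input: the two
  velocity clauses of `MeetsThresholds` then certify nothing beyond `0 < ρ_s.fst` (refines refuter
  rattack-14042-g2's finding C1; the consumer R must not read `v_F`, `v_Δ` unless `D.nodal.Nonempty`).

Work file with the full census and the on-paper probes: `Cruxes/SeededBrokenRegimeBoseFermiPinned/Disproof.lean`.
Sources: folklore (order bookkeeping on the route's own records `SymmetricTolerance`, `HubbardScaleData`,
`hubbardScaleReportCT`); J.-Ll. Figueras, A. Haro, A. Luque, Found. Comput. Math. 17 (2017) Thm. 2.5 for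
the a-posteriori format these records implement [`FiguerasHaroLuque2016`].
-/

namespace Summit.HubbardSuperconductivity.HubbardSuperconductivity.Theorems.SeededBrokenRegimeBoseFermiPinned.Negative

open Summit.HubbardSuperconductivity.HubbardSuperconductivity.Theses.AposterioriCapRg
open Literature.MathematicalPhysics.QuantumLattice

/-! ### The tolerance is monotone for the certificate, antitone for the crux -/

/-- A point certificate at tolerance `Θ` is one at any tolerance with a larger mismatch constant
(`Λ ≥ 0`; `Θ` enters `SymmetricCertifiedAtT` only through `c₀ Λ` in clause (0b′)). [folklore] -/
theorem certifiedAtT_mono_tol {π : SymmetricRegimeDataT} {Θ Θ' : SymmetricTolerance}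
    (hm : Θ.mismatch ≤ Θ'.mismatch) {a b : ℚ} {Λ : ℝ} (hΛ : 0 ≤ Λ) {L M : ℕ} [NeZero L] [NeZero M]
    {β : ℝ} {e : Literature.Probability.LatticeModels.TorusSite 2 L → ℝ} {G : HubbardGrassmann L M}
    {Z : ℂ} (h : SymmetricCertifiedAtT π Θ a b Λ L M β e G Z) :
    SymmetricCertifiedAtT π Θ' a b Λ L M β e G Z := by
  obtain ⟨h0, h1, h2, h3, h4, h5, h6⟩ := h
  refine ⟨h0, fun k hk σ => (h1 k hk σ).trans ?_, h2, h3, h4, h5, h6⟩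
  have : (Θ.mismatch : ℝ) * Λ ≤ (Θ'.mismatch : ℝ) * Λ :=
    mul_le_mul_of_nonneg_right (by exact_mod_cast hm) hΛ
  linarith

/-- **The v3 model certificate is monotone in the tolerance** (componentwise order on `(c₀, w)`).
[folklore] -/
theorem certificateT_mono_tol {Θ Θ' : SymmetricTolerance} (hm : Θ.mismatch ≤ Θ'.mismatch)
    (hw : Θ.width ≤ Θ'.width) {U μ : ℝ} {π : SymmetricRegimeDataT} {K : TrigPolyC4v} {Λ : ℝ} {L₀ : ℕ}
    (h : symmetricRegimeCertificateT U μ π Θ K Λ L₀) : symmetricRegimeCertificateT U μ π Θ' K Λ L₀ := by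
  obtain ⟨h1, h2, h3, a, b, ha, hab, hb, hwid, hblock⟩ := h
  refine ⟨h1, h2, h3, a, b, ha, hab, hb, hwid.trans hw, ?_⟩
  intro L hL _
  obtain ⟨β₀, hβ₀⟩ := hblock L hL
  refine ⟨β₀, fun β hβ => ?_⟩
  obtain ⟨M₀, hM₀⟩ := hβ₀ β hβ
  exact ⟨M₀, fun M hM _ => certifiedAtT_mono_tol hm h2.pos.le (hM₀ M hM)⟩

/-- **The body of the crux is antitone in the tolerance**: whatever is concluded from a certificate at
tolerance `Θ'` at every point of the box is concluded from a certificate at any componentwise smaller `Θ`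
(fewer points are certified); so the crux's `∃ Θ` may be witnessed as small as one likes — the burden
`∀ Θ` sits on the producer `[2]`.  Stated for an arbitrary conclusion `C U μ`. [folklore] -/
theorem seededBrokenRegime_body_antitone {Θ Θ' : SymmetricTolerance} (hm : Θ.mismatch ≤ Θ'.mismatch)
    (hw : Θ.width ≤ Θ'.width) {C : ℝ → ℝ → Prop}
    (h : ∀ U ∈ Set.Icc (2:ℝ) 3, ∀ δ ∈ Set.Icc (1/5:ℝ) (7/20), ∀ μ : ℝ,
      Filter.Tendsto (fun L : ℕ => ((hubbardTorusWith 2 (L + 1) 1 U μ).groundStateFunctional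
        totalNumber).re / ((L + 1 : ℕ) : ℝ) ^ 2) Filter.atTop (nhds (1 - δ)) →
      ∀ (K : TrigPolyC4v) (Λ : ℝ) (L₀ : ℕ),
        symmetricRegimeCertificateT U μ capRgCornerDataT Θ' K Λ L₀ → C U μ) :
    ∀ U ∈ Set.Icc (2:ℝ) 3, ∀ δ ∈ Set.Icc (1/5:ℝ) (7/20), ∀ μ : ℝ,
      Filter.Tendsto (fun L : ℕ => ((hubbardTorusWith 2 (L + 1) 1 U μ).groundStateFunctional
        totalNumber).re / ((L + 1 : ℕ) : ℝ) ^ 2) Filter.atTop (nhds (1 - δ)) →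
      ∀ (K : TrigPolyC4v) (Λ : ℝ) (L₀ : ℕ),
        symmetricRegimeCertificateT U μ capRgCornerDataT Θ K Λ L₀ → C U μ :=
  fun U hU δ hδ μ hd K Λ L₀ hc => h U hU δ hδ μ hd K Λ L₀ (certificateT_mono_tol hm hw hc)

/-! ### `0 < etaStar` is load-bearing exactly up to `0 ≤ etaStar` -/

/-- **The conclusion of the crux forces `0 ≤ etaStar`** (UNCONDITIONAL): a reported tuple has a
nonnegative remainder norm and is enclosed in an interval whose upper end is `≤ etaStar`. [folklore] -/
theorem seededBrokenRegime_concl_etaStar_nonneg {kStar etaStar : ℚ} {U μ : ℝ}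
    (h : ∃ h₀ : ℝ, 0 < h₀ ∧ ∃ D : HubbardScaleData, D.MeetsThresholds kStar etaStar ∧ 0 < D.numPatches ∧
      0 < D.meanFieldDensity.fst ∧
      ∀ h ∈ Set.Ioc (0:ℝ) h₀, ∃ L₀' : ℕ, D.IsCertifiedEnclosure (hubbardScaleReportCT U μ D h) L₀') :
    0 ≤ etaStar := by
  obtain ⟨h₀, hh₀, D, hmeets, -, -, hencl⟩ := h
  obtain ⟨L₀', hcert⟩ := hencl h₀ ⟨hh₀, le_rfl⟩
  obtain ⟨β₀, hβ₀⟩ := hcert L₀' le_rfl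
  obtain ⟨p, hp, henc⟩ := hβ₀ β₀ le_rfl
  have h0 : 0 ≤ p.remainderNorm :=
    remainderNorm_nonneg_of_mem_reportCT (by exact_mod_cast D.scale_pos.le) hp
  have h1 : p.remainderNorm ≤ (etaStar : ℝ) := hmeets.remainderNorm_le henc
  exact_mod_cast h0.trans h1

/-- **With the sign condition on `etaStar` dropped the crux is false at the producer's certified point**
(modulo `[2]` `CapRgSymmetricCertificatePinned`, the only available source of a certificate instance;
witness `etaStar = -1`). [folklore] -/
theorem seededBrokenRegime_anyEta_false_of_capRg (hcap : CapRgSymmetricCertificatePinned) :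
    ¬ ∀ kStar etaStar : ℚ, 0 < kStar → ∃ Θ : SymmetricTolerance,
      ∀ U ∈ Set.Icc (2:ℝ) 3, ∀ δ ∈ Set.Icc (1/5:ℝ) (7/20), ∀ μ : ℝ,
        Filter.Tendsto (fun L : ℕ => ((hubbardTorusWith 2 (L + 1) 1 U μ).groundStateFunctional
          totalNumber).re / ((L + 1 : ℕ) : ℝ) ^ 2) Filter.atTop (nhds (1 - δ)) →
        ∀ (K : TrigPolyC4v) (Λ : ℝ) (L₀ : ℕ),
          symmetricRegimeCertificateT U μ capRgCornerDataT Θ K Λ L₀ →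
            ∃ h₀ : ℝ, 0 < h₀ ∧ ∃ D : HubbardScaleData, D.MeetsThresholds kStar etaStar ∧
              0 < D.numPatches ∧ 0 < D.meanFieldDensity.fst ∧
              ∀ h ∈ Set.Ioc (0:ℝ) h₀, ∃ L₀' : ℕ,
                D.IsCertifiedEnclosure (hubbardScaleReportCT U μ D h) L₀' := by
  intro h
  obtain ⟨Θ, hΘ⟩ := h 1 (-1) one_pos
  obtain ⟨U, hU, δ, hδ, μ, hd, hall⟩ := hcap
  obtain ⟨K, Λ, L₀, hc⟩ := hall Θ
  have := seededBrokenRegime_concl_etaStar_nonneg (hΘ U hU δ hδ μ hd K Λ L₀ hc)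
  norm_num at this

/-! ### The order `∀ kStar etaStar … ∃ D` is load-bearing -/

/-- **No single scale datum meets all stiffness thresholds** (rational arithmetic on the record):
`kStar · Λ₀ · v_F.snd ≤ ρ_s.fst` fails at `kStar = (|ρ_s.fst| + 1)/(Λ₀ · v_F.snd)`. [folklore] -/
theorem hubbardScaleData_not_forall_meetsThresholds (D : HubbardScaleData) (etaStar : ℚ) :
    ¬ ∀ kStar : ℚ, 0 < kStar → D.MeetsThresholds kStar etaStar := by
  intro h
  obtain ⟨-, hvF, -, -⟩ := (h 1 one_pos : D.MeetsThresholdsWith 10 1 etaStar)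
  have hv : 0 < D.fermiVelocity.snd := hvF.trans_le D.fermiVelocity.fst_le_snd
  have hsv : 0 < D.scale * D.fermiVelocity.snd := mul_pos D.scale_pos hv
  set kStar : ℚ := (|D.stiffness.fst| + 1) / (D.scale * D.fermiVelocity.snd) with hk
  have hkpos : 0 < kStar := div_pos (by positivity) hsv
  obtain ⟨-, -, -, h1, -⟩ := (h kStar hkpos : D.MeetsThresholdsWith 10 kStar etaStar)
  have : kStar * D.scale * D.fermiVelocity.snd = |D.stiffness.fst| + 1 := by
    rw [mul_assoc, hk, div_mul_cancel₀ _ hsv.ne']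
  linarith [le_abs_self D.stiffness.fst]

/-- **The uniform-datum strengthening of the crux (`∃ h₀ D` before `∀ kStar etaStar`) is false at the
producer's certified point** (modulo `[2]`). [folklore] -/
theorem seededBrokenRegime_uniformDatum_false_of_capRg (hcap : CapRgSymmetricCertificatePinned) :
    ¬ ∃ Θ : SymmetricTolerance, ∀ U ∈ Set.Icc (2:ℝ) 3, ∀ δ ∈ Set.Icc (1/5:ℝ) (7/20), ∀ μ : ℝ,
      Filter.Tendsto (fun L : ℕ => ((hubbardTorusWith 2 (L + 1) 1 U μ).groundStateFunctional
        totalNumber).re / ((L + 1 : ℕ) : ℝ) ^ 2) Filter.atTop (nhds (1 - δ)) →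
      ∀ (K : TrigPolyC4v) (Λ : ℝ) (L₀ : ℕ), symmetricRegimeCertificateT U μ capRgCornerDataT Θ K Λ L₀ →
        ∃ h₀ : ℝ, 0 < h₀ ∧ ∃ D : HubbardScaleData,
          (∀ kStar etaStar : ℚ, 0 < kStar → 0 < etaStar → D.MeetsThresholds kStar etaStar) ∧
          0 < D.numPatches ∧ 0 < D.meanFieldDensity.fst ∧
          ∀ h ∈ Set.Ioc (0:ℝ) h₀, ∃ L₀' : ℕ, D.IsCertifiedEnclosure (hubbardScaleReportCT U μ D h) L₀' := by
  rintro ⟨Θ, hΘ⟩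
  obtain ⟨U, hU, δ, hδ, μ, hd, hall⟩ := hcap
  obtain ⟨K, Λ, L₀, hc⟩ := hall Θ
  obtain ⟨h₀, -, D, hD, -⟩ := hΘ U hU δ hδ μ hd K Λ L₀ hc
  exact hubbardScaleData_not_forall_meetsThresholds D 1 fun kStar hk => hD kStar 1 hk one_pos

/-! ### With an empty nodal set the velocities of the report are free -/

/-- **With an empty nodal set `IsRealisedAtCT` does not read the velocities**: a realised tuple stays
realised after re-assigning `fermiVelocity` and `gapVelocity` arbitrarily. [folklore] -/
theorem isRealisedAtCT_setVel {L M : ℕ} [NeZero L] {Np : ℕ} {nodal : Finset (Fin Np)} (hn : nodal = ∅)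
    {β U μ h Λ₀ : ℝ} {K : TrigPolyC4v} {p : HubbardScaleData.Parameters Np}
    (hp : IsRealisedAtCT L M β U μ h K Λ₀ Np nodal p) (vF vΔ : ℝ) :
    IsRealisedAtCT L M β U μ h K Λ₀ Np nodal { p with fermiVelocity := vF, gapVelocity := vΔ } := by
  subst hn
  obtain ⟨hβ, q, hev, hgap, hsign, -, hρ, hκ, hm, hη⟩ := hp
  exact ⟨hβ, q, hev, hgap, hsign, fun i hi => by simp at hi, hρ, hκ, hm, hη⟩

/-- The CT report with an empty nodal set is closed under re-assigning the velocities. [folklore] -/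
theorem mem_hubbardScaleReportCTAt_setVel {U μ h Λ₀ : ℝ} {Np : ℕ} {nodal : Finset (Fin Np)}
    (hn : nodal = ∅) {L : ℕ} {β : ℝ} {p : HubbardScaleData.Parameters Np}
    (hp : p ∈ hubbardScaleReportCTAt U μ h Λ₀ Np nodal L β) (vF vΔ : ℝ) :
    { p with fermiVelocity := vF, gapVelocity := vΔ } ∈ hubbardScaleReportCTAt U μ h Λ₀ Np nodal L β := by
  rcases Nat.eq_zero_or_pos L with rfl | hL
  · simp at hp
  · haveI : NeZero L := NeZero.of_pos hL
    rw [mem_hubbardScaleReportCTAt_iff] at hp ⊢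
    intro δ hδ
    refine (hp δ hδ).mono fun M hM => ?_
    obtain ⟨K, hK, p', hp', hclose⟩ := hM
    refine ⟨K, hK, { p' with fermiVelocity := vF, gapVelocity := vΔ }, isRealisedAtCT_setVel hn hp' vF vΔ, ?_⟩
    obtain ⟨h1, h2, h3, -, -, h6, h7⟩ := hclose
    exact ⟨h1, h2, h3, by simp [hδ], by simp [hδ], h6, h7⟩

/-- **A certified datum with empty nodal set stays certified with ARBITRARY velocity enclosures**
(the report never reads the enclosures; the realised tuples are re-assigned with
`mem_hubbardScaleReportCTAt_setVel`). [folklore] -/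
theorem isCertifiedEnclosure_setVel {U μ h : ℝ} {D : HubbardScaleData} (hD : D.nodal = ∅)
    (I J : NonemptyInterval ℚ) {L₀ : ℕ} (hc : D.IsCertifiedEnclosure (hubbardScaleReportCT U μ D h) L₀) :
    ({ D with fermiVelocity := I, gapVelocity := J } : HubbardScaleData).IsCertifiedEnclosure
      (hubbardScaleReportCT U μ { D with fermiVelocity := I, gapVelocity := J } h) L₀ := by
  intro L hL
  obtain ⟨β₀, hβ₀⟩ := hc L hL
  refine ⟨β₀, fun β hβ => ?_⟩
  obtain ⟨p, hp, henc⟩ := hβ₀ β hβ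
  refine ⟨{ p with fermiVelocity := I.fst, gapVelocity := J.fst },
    mem_hubbardScaleReportCTAt_setVel hD hp _ _, ?_⟩
  obtain ⟨hg, hρ, hκ, -, -, hη, hm⟩ := henc
  have hI : ((I.fst : ℚ) : ℝ) ∈ I.ratCast ℝ :=
    NonemptyInterval.mem_ratCast_iff.2 ⟨le_rfl, by exact_mod_cast I.fst_le_snd⟩
  have hJ : ((J.fst : ℚ) : ℝ) ∈ J.ratCast ℝ :=
    NonemptyInterval.mem_ratCast_iff.2 ⟨le_rfl, by exact_mod_cast J.fst_le_snd⟩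
  exact ⟨hg, hρ, hκ, hI, hJ, hη, hm⟩

/-- **The velocity clauses of `MeetsThresholds` are decorative on data with empty nodal set**: a
witness of the crux's conclusion with `D.nodal = ∅` can be re-certified with BOTH velocity enclosures
equal to the point `[ε, ε]`, for every rational `0 < ε ≤ ε₀`, with no model input (`0 < D.numPatches`
notwithstanding).  UNCONDITIONAL. [folklore] -/
theorem seededBrokenRegime_concl_velocities_decorative {kStar etaStar : ℚ} (hk : 0 ≤ kStar) {U μ : ℝ}
    (h : ∃ h₀ : ℝ, 0 < h₀ ∧ ∃ D : HubbardScaleData, D.nodal = ∅ ∧ D.MeetsThresholds kStar etaStar ∧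
      0 < D.numPatches ∧ 0 < D.meanFieldDensity.fst ∧
      ∀ h ∈ Set.Ioc (0:ℝ) h₀, ∃ L₀' : ℕ, D.IsCertifiedEnclosure (hubbardScaleReportCT U μ D h) L₀') :
    ∃ ε₀ : ℚ, 0 < ε₀ ∧ ∀ ε : ℚ, 0 < ε → ε ≤ ε₀ →
      ∃ h₀ : ℝ, 0 < h₀ ∧ ∃ D : HubbardScaleData, D.nodal = ∅ ∧
        D.fermiVelocity = ⟨(ε, ε), le_rfl⟩ ∧ D.gapVelocity = ⟨(ε, ε), le_rfl⟩ ∧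
        D.MeetsThresholds kStar etaStar ∧ 0 < D.numPatches ∧ 0 < D.meanFieldDensity.fst ∧
        ∀ h ∈ Set.Ioc (0:ℝ) h₀, ∃ L₀' : ℕ, D.IsCertifiedEnclosure (hubbardScaleReportCT U μ D h) L₀' := by
  obtain ⟨h₀, hh₀, D, hn, hmeets, hNp, hm, hencl⟩ := h
  obtain ⟨hκ, hvF, hvΔ, h1, h2, h3, h4, h5⟩ := (hmeets : D.MeetsThresholdsWith 10 kStar etaStar)
  refine ⟨min D.fermiVelocity.snd D.gapVelocity.snd,
    lt_min (hvF.trans_le D.fermiVelocity.fst_le_snd) (hvΔ.trans_le D.gapVelocity.fst_le_snd), ?_⟩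
  intro ε hε hεle
  refine ⟨h₀, hh₀, { D with fermiVelocity := ⟨(ε, ε), le_rfl⟩, gapVelocity := ⟨(ε, ε), le_rfl⟩ }, hn,
    rfl, rfl, ?_, hNp, hm, fun h hh => ?_⟩
  · have hks : 0 ≤ kStar * D.scale := mul_nonneg hk D.scale_pos.le
    refine ⟨hκ, hε, hε, ?_, ?_, h3, h4, h5⟩
    · exact (mul_le_mul_of_nonneg_left (hεle.trans (min_le_left _ _)) hks).trans h1
    · exact (mul_le_mul_of_nonneg_left (hεle.trans (min_le_right _ _)) hks).trans h2
  · obtain ⟨L₀', hc⟩ := hencl h hh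
    exact ⟨L₀', isCertifiedEnclosure_setVel hn _ _ hc⟩

end Summit.HubbardSuperconductivity.HubbardSuperconductivity.Theorems.SeededBrokenRegimeBoseFermiPinned.Negative
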